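import Literature.NumberTheory.LFunctions.BurnolSonineZeros
import Literature.NumberTheory.LFunctions.BurnolZetaSystemsHardy
import Literature.NumberTheory.LFunctions.BurnolFourierZetaProofs
import Literature.NumberTheory.LFunctions.BurnolSonineFourier
import HarnessLib

/-!
# Burnol, *On Fourier and Zeta(s)* (Forum Math. 2004), §6 "Sonine spaces of de Branges": the chain
# `K_λ`, its filtration, and the Fourier symmetry of the evaluators `Z^λ_{w,k}` (statements; Part 2 of
# `BurnolFourierZeta.lean`)

LINE 1 — LABEL: RH-FREE (Hilbert-space analysis of even `L²` functions vanishing near `0` together with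
their cosine transform; no hypothesis and no conclusion about zeros of `ζ`). FRAMING (cell rh-crit,
D-0074): corpus theorems are RH-FREE literature. bears_on: B-C/B-P (LADDER-RH COLUMN 6, de Branges
framework). WHAT THIS IS NOT: not a route, not an RH criterion, no positivity condition at `E_ζ` is
asserted (Conrey–Li guard); nothing here bears on the truth of RH.

Source: J.-F. Burnol, *On Fourier and Zeta(s)*, Forum Math. **16** (2004) 789–840 = arXiv:math/0112254
[Burnol2004] (TeX of record `rh-crit/dbl/src/Burnol2004ForumMath_arXivmath0112254.tex`; statement lines
`TeX l.nnn`), §6 (TeX l.2190–2400). Part 1 (§§3–5: co-Poisson sums, Thms. 3.8/3.9/4.2/4.4/4.5, the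
vectors `V₃`) is `BurnolFourierZeta.lean` / `BurnolFourierZetaProofs.lean`.

## Dictionary §6 ↦ tree (nothing is re-declared; the Sonine-space vocabulary is dbl-t14's
`BurnolZetaSystems.lean` / `BurnolSonineZeros.lean`, typed from the companion paper [Burnol2004b])

* **Definition 6.1** (TeX l.2224–2228) "`K_λ ⊂ K` = the square-integrable (even) `f` vanishing in
  `(0,λ)` with `𝓕₊(f)` vanishing in `(0,λ)`" ↦ EXACTLY `Literature.NumberTheory.LFunctions.sonineK λ`
  (ambient `K` ↦ `evenL2`; `𝓕₊` on even classes ↦ Mathlib's `L²` Fourier transform `𝓕`). Cited, not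
  restated. Proved below from the definition: `zero_mem_sonineK`, `sonineK_antitone` (the `K_λ`
  decrease), `isClosed_evenL2`, `isClosed_sonineK` (each `K_λ` is a closed = Hilbert subspace-as-set).
* **Theorem 6.3** (TeX l.2313–2325; "most of this is, up to a change of variable, from [Bra64] …
  We provide elementary proofs of all statements in [cras2]"): "The spaces `K_λ` are all non-reduced
  to `{0}`. The Mellin transforms of elements of `K_λ` are entire functions with trivial zeros at
  `s = −2n`. `M(f)(s) = π^{−s/2}Γ(s/2)f̂(s)` satisfy `M(𝓕₊(f))(s) = M(f)(1−s)`. For each `w ∈ ℂ`,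
  `k ∈ ℕ`, the linear forms `f ↦ M(f)^{(k)}(w)` are continuous and correspond to (unique) vectors
  `Z^λ_{w,k} ∈ K_λ`." ↦ the tree's typing of the SAME theorem from [Burnol2004b]:
  `Burnol2004b_thm2_1` (entire continuation with the trivial zeros; continuity of the evaluations,
  `k = 0`), `Burnol2004b_prop2_2` (iii) (the functional equation, on `L_a ⊇ K_a`) and (ii) (the
  derivative evaluations), `Burnol2004b_prop4_7` (proper inclusions `⋃_{b>a} K_b ⊊ K_a`, which contain
  the non-triviality) — CITED, not restated; the elementary proofs "[cras2]" are dbl-t2's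
  `Literature.Analysis.DeBrangesSpaces.Burnol2001.Burnol2001CRAS_thm1_1` ff. (model `H_Λ = I·K_{1/Λ}`).
  Proved below: `exists_ne_zero_mem_sonineK_of` — the first clause "`K_λ ≠ {0}`" from
  `Burnol2004b_prop4_7`, and UNCONDITIONALLY for `0 < λ < 1` by Burnol's co-Poisson construction:
  `exists_ne_zero_mem_sonineK_of_lt_one`. The evaluators at every `w` are `IsSonineZ` / `sonineZ` (`BurnolSonineZeros.lean`).
* **Proposition 6.6** (TeX l.2351–2355) "`K_λ = ⋂_{μ<λ} K_μ` and `K_λ = closure ⋃_{μ>λ} K_μ`. Furthermore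
  `L²((0,∞),dt) = closure ⋃_{λ>0} K_λ`." ↦ (i) PROVED (`sonineK_eq_iInter`); (ii) is
  `Burnol2004b_prop4_6` (first clause, "`⋃_{b>a} K_b` is dense in `K_a`") — cited; the printed EQUALITY
  is derived from it and closedness (`sonineK_eq_closure_iUnion_of`); (iii) is the named fact
  `Burnol2004_prop_6_6` below (not elsewhere in the tree in the `K_λ` model; the `H_Λ`-model analogue
  is `Burnol2001CRAS_prop2_1`).
* **Proposition 6.7** (TeX l.2372–2374) "`𝓕₊(Z^λ_{w,k}) = (−1)^k Z^λ_{1−w,k}`" ↦ named fact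
  `Burnol2004_prop_6_7`, over `IsSonineZ` (the defining relation of the evaluator at ANY `w`).
* **Theorem 6.8** (TeX l.2388–2392, "[cras2]") "Any finite collection of vectors `Z^λ_{w,k}` is a
  linearly independent system" ↦ this IS [Burnol2001CRAS, Thm. 2.3], typed in the tree as
  `Literature.Analysis.DeBrangesSpaces.Burnol2001.Burnol2001CRAS_thm2_3` (model `H_Λ = I·K_{1/Λ}`,
  `I f(t) = f(1/t)/t` unitary, carrying evaluators to evaluators) — cited, not restated in the `K_λ` model.

* **Co-Poisson examples of Sonine functions** (§6 opening, TeX l.2190–2203: "The intertwining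
  property … shows how to give examples of even functions `f(t)` which vanish identically in a
  neighborhood `(−λ,λ)` of the origin and such that their Fourier cosine transform has the same
  property. For this we take `α(t)` smooth with support in `[λ,Λ]` (`Λ = 1/λ`) and such that
  `∫₀^∞ α(t)dt = 0 = ∫₀^∞ (α(1/t)/t)dt`") ↦ PROVED: `CoPoisson.IsTestAway.toLp_coSum_mem_sonineK`
  (the `L²` class of `P'(α)` lies in `K_λ`, from Thms 3.8/4.4 of `BurnolFourierZetaProofs.lean` and
  the tree's `L¹ ∩ L²` Plancherel bridge), with the non-vanishing criterion
  `CoPoisson.IsTestAway.toLp_coSum_ne_zero` and the formula `P'(α) = α − ∫₀^∞α(u)du/u` on `|y| < 2λ`.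

Deliberately NOT here: the existence discussion TeX l.2230–2290 (Sonine's and de Branges' examples,
Kahane's regularisation of Poisson-type distributions, the closed-range argument via
`‖P_λ𝓕₊P_λ‖ < 1` [Dym–McKean]) — prose, no numbered statement; the augmented spaces `L_λ` and Thm. 6.9 ff.
(TeX l.2394–) — the tree's `sonineL`, `Burnol2004b_prop2_2`.
-/

noncomputable section

open MeasureTheory Complex Filter Set FourierTransform
open scoped FourierTransform Topology ENNReal

namespace Literature.NumberTheory.LFunctions

/-! ## Definition 6.1: elementary structure of the chain `K_λ` (proved from the definition) -/

/-- RH-FREE (bookkeeping for Def. 6.1). `0 ∈ K_a`. [cite: Burnol2004, Definition 6.1 (TeX l.2224–2228)] -/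
theorem zero_mem_sonineK (a : ℝ) : (0 : Lp ℂ 2 (volume : Measure ℝ)) ∈ sonineK a := by
  have h0 : ⇑(0 : Lp ℂ 2 (volume : Measure ℝ)) =ᵐ[volume] 0 := Lp.coeFn_zero ℂ 2 volume
  have h0' : ∀ᵐ x : ℝ, (0 : Lp ℂ 2 (volume : Measure ℝ)) (-x) = 0 :=
    (Measure.measurePreserving_neg (volume : Measure ℝ)).quasiMeasurePreserving.ae h0
  refine ⟨?_, ?_, ?_⟩
  · filter_upwards [h0, h0'] with x hx hx'
    rw [hx', hx]; rfl
  · filter_upwards [h0] with x hx _ using hx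
  · rw [FourierTransform.fourier_zero (E := Lp ℂ 2 (volume : Measure ℝ))]
    filter_upwards [h0] with x hx _ using hx

/-- RH-FREE (Def. 6.1: "the `K_λ`'s form a decreasing chain as `λ → ∞`", TeX l.2358). `a ≤ b → K_b ⊆ K_a`.
[cite: Burnol2004, Definition 6.1 and proof of Prop. 6.6 (TeX l.2224–2228, 2357–2359)] -/
theorem sonineK_antitone {a b : ℝ} (hab : a ≤ b) : sonineK b ⊆ sonineK a := by
  rintro f ⟨he, h1, h2⟩
  refine ⟨he, ?_, ?_⟩
  · filter_upwards [h1] with x hx hxa using hx ⟨hxa.1, hxa.2.trans_le hab⟩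
  · filter_upwards [h2] with x hx hxa using hx ⟨hxa.1, hxa.2.trans_le hab⟩

/-- `L²`-limits preserve "a.e. zero on `S`": the set of classes vanishing a.e. on a fixed set is closed
(a convergent sequence in `L²` has an a.e. convergent subsequence). [folklore] -/
private lemma isClosed_setOf_ae_eq_zero (S : Set ℝ) :
    IsClosed {f : Lp ℂ 2 (volume : Measure ℝ) | ∀ᵐ x : ℝ, x ∈ S → f x = 0} := by
  refine IsSeqClosed.isClosed fun u f hu huf => ?_
  obtain ⟨ns, -, hns⟩ := (tendstoInMeasure_of_tendsto_Lp huf).exists_seq_tendsto_ae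
  have hall : ∀ᵐ x : ℝ, ∀ i, x ∈ S → u (ns i) x = 0 := ae_all_iff.2 fun i => hu (ns i)
  filter_upwards [hns, hall] with x hx hx' hxS
  exact tendsto_nhds_unique hx (tendsto_const_nhds.congr fun i => (hx' i hxS).symm)

/-- RH-FREE (bookkeeping). Burnol's `K` (the a.e.-even classes) is closed in `L²(ℝ)`.
[cite: Burnol2004, §6 (TeX l.2224–2228); Burnol2004b, §1 Note (TeX l.295–309)] -/
theorem isClosed_evenL2 : IsClosed (evenL2 : Set (Lp ℂ 2 (volume : Measure ℝ))) := by
  refine IsSeqClosed.isClosed fun u f hu huf => ?_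
  obtain ⟨ns, -, hns⟩ := (tendstoInMeasure_of_tendsto_Lp huf).exists_seq_tendsto_ae
  have hns' : ∀ᵐ x : ℝ, Tendsto (fun i => u (ns i) (-x)) atTop (𝓝 (f (-x))) :=
    (Measure.measurePreserving_neg (volume : Measure ℝ)).quasiMeasurePreserving.ae hns
  have hall : ∀ᵐ x : ℝ, ∀ i, u (ns i) (-x) = u (ns i) x := ae_all_iff.2 fun i => hu (ns i)
  filter_upwards [hns, hns', hall] with x hx hx' hxe
  exact tendsto_nhds_unique (hx'.congr fun i => hxe i) hx

/-- RH-FREE (bookkeeping for Def. 6.1: "`K_λ ⊂ K` [is] the Hilbert space of …"). Each `K_a` is a closed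
subset of `L²(ℝ)` (intersection of three closed conditions; the third through the continuity of the
`L²` Fourier transform). [cite: Burnol2004, Definition 6.1 (TeX l.2224–2228)] -/
theorem isClosed_sonineK (a : ℝ) : IsClosed (sonineK a) := by
  have hF : IsClosed ((fun f : Lp ℂ 2 (volume : Measure ℝ) => (𝓕 f : Lp ℂ 2 (volume : Measure ℝ))) ⁻¹'
      {g : Lp ℂ 2 (volume : Measure ℝ) | ∀ᵐ x : ℝ, x ∈ Set.Ioo 0 a → g x = 0}) :=
    (isClosed_setOf_ae_eq_zero (Set.Ioo 0 a)).preimage continuous_fourier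
  have h : sonineK a = evenL2 ∩ {f : Lp ℂ 2 (volume : Measure ℝ) | ∀ᵐ x : ℝ, x ∈ Set.Ioo 0 a → f x = 0} ∩
      ((fun f : Lp ℂ 2 (volume : Measure ℝ) => (𝓕 f : Lp ℂ 2 (volume : Measure ℝ))) ⁻¹'
        {g : Lp ℂ 2 (volume : Measure ℝ) | ∀ᵐ x : ℝ, x ∈ Set.Ioo 0 a → g x = 0}) := by
    ext f
    simp only [sonineK, Set.mem_setOf_eq, Set.mem_inter_iff, Set.mem_preimage]
    tauto
  rw [h]
  exact (isClosed_evenL2.inter (isClosed_setOf_ae_eq_zero _)).inter hF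

/-! ## Theorem 6.3, first clause: `K_λ ≠ {0}` (from the cited proper-inclusion fact) -/

/-- RH-FREE (Thm. 6.3, first clause: "The spaces `K_λ` are all non-reduced to `{0}`"), derived here
from the tree's typing of [Burnol2004b, Prop. 4.7] (`⋃_{b>a} K_b ⊊ K_a`): a proper superset of a set
containing `0` has a non-zero element. The remaining clauses of Thm. 6.3 are the tree's
`Burnol2004b_thm2_1` / `Burnol2004b_prop2_2` (module docstring).
[cite: Burnol2004, Theorem 6.3 (TeX l.2313–2325)] -/
theorem exists_ne_zero_mem_sonineK_of (h : Burnol2004b_prop4_7) {a : ℝ} (ha : 0 < a) :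
    ∃ f ∈ sonineK a, f ≠ 0 := by
  obtain ⟨⟨-, hnot⟩, -⟩ := (h a ha).1
  by_contra hcon
  push Not at hcon
  apply hnot
  intro f hf
  rw [hcon f hf]
  exact Set.mem_biUnion (show a + 1 ∈ Set.Ioi a by simp) (zero_mem_sonineK (a + 1))

/-! ## Proposition 6.6: the filtration -/

/-- RH-FREE (Prop. 6.6 (i), PROVED: "Directly from the definition, the `K_λ`'s form a decreasing chain
as `λ → ∞` and the first statement holds"). `K_λ = ⋂_{μ<λ} K_μ` for `λ > 0` (for `μ ≤ 0` the
conditions of `K_μ` are vacuous, `K_μ = K`, so the intersection over all `μ < λ` equals the printed one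
over `0 < μ < λ`). [cite: Burnol2004, Proposition 6.6 (TeX l.2351–2359)] -/
theorem sonineK_eq_iInter {lam : ℝ} (hlam : 0 < lam) :
    sonineK lam = ⋂ μ ∈ Set.Iio lam, sonineK μ := by
  apply Set.Subset.antisymm
  · exact Set.subset_iInter₂ fun μ hμ => sonineK_antitone (le_of_lt hμ)
  · intro f hf
    rw [Set.mem_iInter₂] at hf
    -- the sequence `μ_n = λ·n/(n+1) ↑ λ`
    set μ : ℕ → ℝ := fun n => lam * n / (n + 1) with hμ
    have hμlt : ∀ n, μ n < lam := fun n => by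
      rw [hμ]; dsimp only
      rw [div_lt_iff₀ (by positivity)]; nlinarith
    have hmem : ∀ n, f ∈ sonineK (μ n) := fun n => hf (μ n) (hμlt n)
    have hcov : ∀ x ∈ Set.Ioo 0 lam, ∃ n : ℕ, x ∈ Set.Ioo 0 (μ n) := by
      intro x hx
      obtain ⟨n, hn⟩ := exists_nat_gt (x / (lam - x))
      refine ⟨n, hx.1, ?_⟩
      have hlx : 0 < lam - x := sub_pos.2 hx.2
      rw [div_lt_iff₀ hlx] at hn
      rw [hμ]; dsimp only
      rw [lt_div_iff₀ (by positivity)]; nlinarith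
    refine ⟨(hmem 0).1, ?_, ?_⟩
    · have hall : ∀ᵐ x : ℝ, ∀ n, x ∈ Set.Ioo 0 (μ n) → f x = 0 := ae_all_iff.2 fun n => (hmem n).2.1
      filter_upwards [hall] with x hx hxl
      obtain ⟨n, hn⟩ := hcov x hxl
      exact hx n hn
    · have hall : ∀ᵐ x : ℝ, ∀ n, x ∈ Set.Ioo 0 (μ n) → (𝓕 f : Lp ℂ 2 (volume : Measure ℝ)) x = 0 :=
        ae_all_iff.2 fun n => (hmem n).2.2
      filter_upwards [hall] with x hx hxl
      obtain ⟨n, hn⟩ := hcov x hxl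
      exact hx n hn

/-- RH-FREE (Prop. 6.6 (ii) "`K_λ = closure ⋃_{μ>λ} K_μ`", derived: the inclusion `⊆` is the tree's
typing of [Burnol2004b, Prop. 4.6] ("`⋃_{b>a} K_b` is dense in `K_a`"), cited as the hypothesis; `⊇` is
`sonineK_antitone` + `isClosed_sonineK`). [cite: Burnol2004, Proposition 6.6 (TeX l.2351–2368)] -/
theorem sonineK_eq_closure_iUnion_of (h : Burnol2004b_prop4_6) {lam : ℝ} (hlam : 0 < lam) :
    sonineK lam = closure (⋃ μ ∈ Set.Ioi lam, sonineK μ) := by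
  apply Set.Subset.antisymm
  · exact (h lam hlam).1
  · exact closure_minimal (Set.iUnion₂_subset fun μ hμ => sonineK_antitone (le_of_lt hμ))
      (isClosed_sonineK lam)

/-- RH-FREE (named fact, Prop. 6.6 (iii)). "Furthermore `L²((0,∞),dt) = closure ⋃_{λ>0} K_λ`" — with
`L²((0,∞),dt) = K` ↦ `evenL2` (closed: `isClosed_evenL2`). Printed proof: the argument of (ii) ("Let
`φ` be perpendicular to each `K_μ` … the entire function `g^μ` must then not depend on `μ` … The same
proof shows the last statement", TeX l.2360–2368). The `H_Λ = I·K_{1/Λ}`-model analogue is the tree's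
`Literature.Analysis.DeBrangesSpaces.Burnol2001.Burnol2001CRAS_prop2_1` (second clause).
[cite: Burnol2004, Proposition 6.6 (TeX l.2351–2368)] -/
def Burnol2004_prop_6_6 : Prop :=
  closure (⋃ lam ∈ Set.Ioi (0 : ℝ), sonineK lam) = (evenL2 : Set (Lp ℂ 2 (volume : Measure ℝ)))

/-- RH-FREE (the trivial half of Prop. 6.6 (iii), PROVED): `closure ⋃_{λ>0} K_λ ⊆ K`.
[cite: Burnol2004, Proposition 6.6 (TeX l.2351–2355)] -/
theorem closure_iUnion_sonineK_subset_evenL2 :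
    closure (⋃ lam ∈ Set.Ioi (0 : ℝ), sonineK lam) ⊆ (evenL2 : Set (Lp ℂ 2 (volume : Measure ℝ))) :=
  closure_minimal (Set.iUnion₂_subset fun _ _ _ hf => hf.1) isClosed_evenL2

/-! ## Proposition 6.7: Fourier symmetry of the evaluators -/

/-- RH-FREE (named fact, Prop. 6.7). "One has `𝓕₊(Z^λ_{w,k}) = (−1)^k Z^λ_{1−w,k}`." Printed proof:
"Using the Euclid bilinear form: `[𝓕₊(Z^λ_{w,k}), f] = [Z^λ_{w,k}, 𝓕₊(f)] = M(𝓕₊(f))^{(k)}(w) =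
(−1)^k M(f)^{(k)}(1−w)` from `M(𝓕₊(f))(w) = M(f)(1−w)`." Typed over the DEFINING RELATION of the
evaluators at an arbitrary `w ∈ ℂ` (`IsSonineZ λ w k Z`: `Z ∈ K_λ` and `∫₀^∞ f Z = 𝒢_f^{(k)}(w)` for all
`f ∈ K_λ`, `𝒢_f` the entire completed Mellin transform, `BurnolSonineZeros.lean`): if `Z` is the
evaluator at `(w,k)` then `(−1)^k 𝓕(Z)` is the evaluator at `(1−w,k)` — by the uniqueness of the
evaluators (Thm. 6.3) this is the printed identity between THE vectors `Z^λ_{w,k}`.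
[cite: Burnol2004, Proposition 6.7 (TeX l.2372–2380)] -/
def Burnol2004_prop_6_7 : Prop :=
  ∀ lam : ℝ, 0 < lam → ∀ (w : ℂ) (k : ℕ) (Z : Lp ℂ 2 (volume : Measure ℝ)),
    IsSonineZ lam w k Z →
      IsSonineZ lam (1 - w) k (((-1 : ℂ) ^ k) • (𝓕 Z : Lp ℂ 2 (volume : Measure ℝ)))


/-! ## Co-Poisson examples of Sonine functions (§6 opening, TeX l.2190–2203) -/

section CoPoissonExamples

open CoPoisson

variable {α : ℝ → ℂ}

/-- `∫₀^∞ I(α)(u) du/u = ∫₀^∞ α` (the substitution `u ↦ 1/u`). [folklore] -/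
private theorem integral_Ioi_inv_div' (α : ℝ → ℂ) :
    ∫ u in Ioi (0 : ℝ), CoPoisson.inv α u / (u : ℂ) = ∫ v in Ioi (0 : ℝ), α v := by
  have h := integral_comp_rpow_Ioi (fun v : ℝ ↦ α v) (p := -1) (by norm_num)
  rw [← h]
  refine setIntegral_congr_fun measurableSet_Ioi fun x hx ↦ ?_
  have hx0 : (0 : ℝ) < x := hx
  simp only [Real.rpow_neg_one, CoPoisson.inv, abs_of_pos hx0]
  have hx2 : x ^ ((-1 : ℝ) - 1) = (x ^ 2)⁻¹ := by
    rw [show ((-1 : ℝ) - 1) = -2 by norm_num, Real.rpow_neg hx0.le, Real.rpow_two]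
  rw [hx2, abs_neg, abs_one, one_mul, Complex.real_smul]
  have hxC : (x : ℂ) ≠ 0 := by exact_mod_cast hx0.ne'
  push_cast
  field_simp

/-- For `α` vanishing on `(−λ, λ)`: `P'(α)(y) = α(y) − ∫₀^∞ α(u)du/u` for `|y| < 2λ` (only the
term `n = 1` of the co-Poisson sum survives). [cite: Burnol2004, §6 (TeX l.2190–2203)] -/
theorem CoPoisson.coSum_eq_sub_of_abs_lt {a : ℝ} (hz : ∀ y, |y| < a → α y = 0) {y : ℝ}
    (hy : |y| < 2 * a) :
    coSum α y = α y - ∫ u in Ioi (0 : ℝ), α u / (u : ℂ) := by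
  rw [coSum]
  congr 1
  rw [tsum_eq_single 0]
  · simp
  · intro n hn
    have hn1 : (2 : ℝ) ≤ (n : ℝ) + 1 := by
      have : 1 ≤ n := Nat.one_le_iff_ne_zero.2 hn
      have : (1 : ℝ) ≤ n := by exact_mod_cast this
      linarith
    have hpos : (0 : ℝ) < (n : ℝ) + 1 := by positivity
    have : |y / ((n : ℝ) + 1)| < a := by
      rw [abs_div, abs_of_pos hpos, div_lt_iff₀ hpos]
      nlinarith [abs_nonneg y]
    simp [hz _ this]

/-- **Co-Poisson sums with two vanishing moments are Sonine functions** (§6 opening: "we take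
`α(t)` smooth with support in `[λ,Λ]` (`Λ = 1/λ`) and such that `∫₀^∞ α(t)dt = 0 =
∫₀^∞ (α(1/t)/t)dt`"; then `P'(α)` vanishes on `(−λ,λ)` and so does its Fourier transform
`P'(Iα)`): the `L²` class of `P'(α)` belongs to `K_λ`. Inputs: Thm 3.8 (`P'(α) ∈ L²`), Thm 4.4
(`𝓕(P'(α)) = P'(Iα)`), and the `L¹ ∩ L²` consistency of the `L²` Fourier transform
(`Literature.Analysis.FunctionSpaces.fourier_toLp_ae_eq_fourierIntegral`).
[cite: Burnol2004, §6 (TeX l.2190–2203)] -/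
theorem CoPoisson.IsTestAway.toLp_coSum_mem_sonineK (h : IsTestAway α) {a : ℝ} (ha : 0 < a)
    (hz : ∀ y, |y| < a → α y = 0) (hz' : ∀ y, a⁻¹ < |y| → α y = 0)
    (h0 : ∫ u in Ioi (0 : ℝ), α u = 0) (h1 : ∫ u in Ioi (0 : ℝ), α u / (u : ℂ) = 0) :
    h.memLp_two_coSum.toLp (coSum α) ∈ sonineK a := by
  set f : Lp ℂ 2 (volume : Measure ℝ) := h.memLp_two_coSum.toLp (coSum α) with hf
  have hae : ⇑f =ᵐ[volume] coSum α := MemLp.coeFn_toLp _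
  -- `P'(α)` vanishes on `(−a, a)`
  have hzero : ∀ y : ℝ, |y| < a → coSum α y = 0 := by
    intro y hy
    rw [coSum_eq_sub_of_abs_lt hz (by linarith [abs_nonneg y]), hz y hy, h1, sub_zero]
  -- and so does `P'(Iα)`
  have hzero' : ∀ y : ℝ, 0 < y → y < a → coSum (CoPoisson.inv α) y = 0 := by
    intro y hy0 hy
    rw [coSum, integral_Ioi_inv_div', h0, sub_zero]
    refine (tsum_congr fun n ↦ ?_).trans tsum_zero
    have hpos : (0 : ℝ) < (n : ℝ) + 1 := by positivity
    have harg : a⁻¹ < |((n : ℝ) + 1) / y| := by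
      rw [abs_div, abs_of_pos hpos, abs_of_pos hy0, lt_div_iff₀ hy0]
      calc a⁻¹ * y < a⁻¹ * a := by gcongr
        _ = 1 := inv_mul_cancel₀ ha.ne'
        _ ≤ (n : ℝ) + 1 := by linarith [show (0 : ℝ) ≤ n from Nat.cast_nonneg n]
    have hval : α (((n : ℝ) + 1) / y) = 0 := hz' _ harg
    simp [CoPoisson.inv, inv_div, hval]
  refine ⟨?_, ?_, ?_⟩
  · -- even
    have hae' : ∀ᵐ x : ℝ, f (-x) = coSum α (-x) :=
      (Measure.measurePreserving_neg (volume : Measure ℝ)).quasiMeasurePreserving.ae hae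
    filter_upwards [hae, hae'] with x hx hx'
    rw [hx', hx, coSum_neg h.even]
  · filter_upwards [hae] with x hx hxa
    rw [hx]
    exact hzero x (by rw [abs_of_pos hxa.1]; exact hxa.2)
  · have hF := Literature.Analysis.FunctionSpaces.fourier_toLp_ae_eq_fourierIntegral
      h.integrable_coSum h.memLp_two_coSum
    have h44 : 𝓕 (coSum α) = coSum (CoPoisson.inv α) := Burnol2004_thm_4_4_holds α h
    filter_upwards [hF] with x hx hxa
    rw [hx, h44]
    exact hzero' x hxa.1 hxa.2

/-- Non-vanishing criterion for the Sonine function `P'(α)`: if `P'(α)(y₀) ≠ 0` for some `y₀`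
(e.g. `α(y₀) ≠ ∫₀^∞α(u)du/u` with `|y₀| < 2λ`, by `coSum_eq_sub_of_abs_lt`) then its `L²` class is
non-zero (`P'(α)` is continuous). [cite: Burnol2004, §6 (TeX l.2190–2203)] -/
theorem CoPoisson.IsTestAway.toLp_coSum_ne_zero (h : IsTestAway α) {y₀ : ℝ} (hy₀ : coSum α y₀ ≠ 0) :
    h.memLp_two_coSum.toLp (coSum α) ≠ 0 := by
  intro hzero
  have hae : ⇑(h.memLp_two_coSum.toLp (coSum α)) =ᵐ[volume] coSum α := MemLp.coeFn_toLp _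
  rw [hzero] at hae
  have h0 : (coSum α) =ᵐ[volume] (fun _ ↦ (0 : ℂ)) := by
    filter_upwards [hae, Lp.coeFn_zero ℂ 2 (volume : Measure ℝ)] with x hx hx0
    rw [← hx, hx0]; rfl
  have heq : coSum α = fun _ ↦ (0 : ℂ) :=
    (Continuous.ae_eq_iff_eq (μ := volume) h.continuous_coSum continuous_const).1 h0
  exact hy₀ (congrFun heq y₀)

/-- Integrability of `u ↦ φ(u)/u` for a compactly supported continuous `φ` vanishing on
`(−a, a)`, `a > 0`. [folklore] -/
private theorem integrable_div_of_vanish {φ : ℝ → ℝ} (hφc : Continuous φ) (hφs : HasCompactSupport φ)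
    {a : ℝ} (ha : 0 < a) (hz : ∀ u, |u| < a → φ u = 0) :
    Integrable fun u : ℝ ↦ φ u / u := by
  have hint : Integrable φ := hφc.integrable_of_hasCompactSupport hφs
  refine (hint.norm.mul_const a⁻¹).mono' (hφc.measurable.mul measurable_inv).aestronglyMeasurable
    (Eventually.of_forall fun u ↦ ?_)
  by_cases hu : |u| < a
  · simp [hz u hu]
  · rw [not_lt] at hu
    rw [norm_div, Real.norm_eq_abs, Real.norm_eq_abs, div_eq_mul_inv]
    exact mul_le_mul_of_nonneg_left (inv_anti₀ ha hu) (abs_nonneg _)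

/-- **Test functions with two vanishing moments** (the input of Burnol's construction, TeX
l.2199–2201: "`α(t)` smooth with support in `[λ,Λ]` and such that `∫₀^∞ α(t)dt = 0 =
∫₀^∞ (α(1/t)/t)dt`"): for `0 < a < b` there is a smooth even `α`, supported in `a ≤ |y| ≤ b`,
with `∫₀^∞ α = 0 = ∫₀^∞ α(u)du/u` and `α(y₀) ≠ 0` at some `y₀ ∈ (a,b)`. Construction: three
disjoint bumps `φ₁, φ₂, φ₃` in `(a,b)` combined with the cross product of their moment vectors
`(∫φᵢ)ᵢ × (∫φᵢ/u)ᵢ` as coefficients; the coefficient of `φ₃` is `∫φ₁·∫φ₂/u − ∫φ₂·∫φ₁/u < 0`.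
[folklore] -/
private theorem exists_testAway_moments {a b : ℝ} (ha : 0 < a) (hab : a < b) :
    ∃ α : ℝ → ℂ, IsTestAway α ∧ (∀ y, |y| < a → α y = 0) ∧ (∀ y, b < |y| → α y = 0) ∧
      (∫ u in Ioi (0 : ℝ), α u = 0) ∧ (∫ u in Ioi (0 : ℝ), α u / (u : ℂ) = 0) ∧
      ∃ y₀ : ℝ, a < y₀ ∧ y₀ < b ∧ α y₀ ≠ 0 := by
  -- geometry of the three bumps
  set d : ℝ := b - a with hd
  have hd0 : 0 < d := by rw [hd]; linarith
  set r : ℝ := d / 10 with hr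
  have hr0 : 0 < r := by positivity
  set c : Fin 3 → ℝ := ![a + d / 4, a + d / 2, a + 3 * d / 4] with hc
  have hc0 : c 0 = a + d / 4 := rfl
  have hc1 : c 1 = a + d / 2 := rfl
  have hc2 : c 2 = a + 3 * d / 4 := rfl
  have hcin : ∀ i : Fin 3, a + r < c i ∧ c i + r < b := by
    intro i; fin_cases i <;> simp only [hc0, hc1, hc2, Fin.zero_eta, Fin.mk_one, Fin.reduceFinMk] <;>
      constructor <;> linarith
  set φ : ∀ i : Fin 3, ContDiffBump (c i) := fun i ↦ ⟨r / 2, r, by positivity, by linarith⟩ with hφ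
  have hφr : ∀ i, (φ i).rOut = r := fun i ↦ rfl
  have hφrIn : ∀ i, (φ i).rIn = r / 2 := fun i ↦ rfl
  -- vanishing of the bumps outside `(a, b)` and at the other centres
  have hφzero : ∀ (i : Fin 3) (u : ℝ), r ≤ |u - c i| → φ i u = 0 := by
    intro i u hu
    exact (φ i).zero_of_le_dist (by rw [hφr, Real.dist_eq]; exact hu)
  have hφzero_small : ∀ (i : Fin 3) (u : ℝ), u ≤ a → φ i u = 0 := by
    intro i u hu
    refine hφzero i u ?_
    have := (hcin i).1
    rw [abs_sub_comm, abs_of_pos (by linarith)]; linarith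
  have hφzero_large : ∀ (i : Fin 3) (u : ℝ), b ≤ u → φ i u = 0 := by
    intro i u hu
    refine hφzero i u ?_
    have := (hcin i).2
    rw [abs_of_pos (by linarith)]; linarith
  have hφsupp : ∀ (i : Fin 3) (u : ℝ), φ i u ≠ 0 → a < u ∧ u < b := by
    intro i u hu
    constructor
    · by_contra h; exact hu (hφzero_small i u (not_lt.1 h))
    · by_contra h; exact hu (hφzero_large i u (not_lt.1 h))
  -- the moments
  have hφint : ∀ i, Integrable (fun u : ℝ ↦ φ i u) :=
    fun i ↦ (φ i).continuous.integrable_of_hasCompactSupport (φ i).hasCompactSupport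
  have hφint' : ∀ i, Integrable (fun u : ℝ ↦ φ i u / u) := fun i ↦
    integrable_div_of_vanish (φ i).continuous (φ i).hasCompactSupport ha
      (fun u hu ↦ hφzero_small i u (le_of_lt (lt_of_le_of_lt (le_abs_self u) hu)))
  set m : Fin 3 → ℝ := fun i ↦ ∫ u in Ioi (0 : ℝ), φ i u with hm
  set n : Fin 3 → ℝ := fun i ↦ ∫ u in Ioi (0 : ℝ), φ i u / u with hn
  have hm_eq : ∀ i, m i = ∫ u : ℝ, φ i u := by
    intro i
    exact setIntegral_eq_integral_of_forall_compl_eq_zero fun u hu ↦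
      hφzero_small i u (le_of_lt (lt_of_le_of_lt (not_lt.1 hu) ha))
  have hm_pos : ∀ i, 0 < m i := fun i ↦ by rw [hm_eq]; exact (φ i).integral_pos
  -- `n 0 ≥ m 0/(c 0 + r)` and `n 1 ≤ m 1/(c 1 - r)`
  have hc0r : 0 < c 0 + r := by have := (hcin 0).1; linarith
  have hc1r : 0 < c 1 - r := by have := (hcin 1).1; linarith
  have hn0 : m 0 / (c 0 + r) ≤ n 0 := by
    rw [hm, hn]; dsimp only
    rw [← integral_div]
    refine setIntegral_mono_on ((hφint 0).div_const _).integrableOn (hφint' 0).integrableOn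
      measurableSet_Ioi fun u hu ↦ ?_
    have hu0 : (0 : ℝ) < u := hu
    by_cases hφu : φ 0 u = 0
    · simp [hφu]
    · have hle : u ≤ c 0 + r := by
        by_contra hlt
        exact hφu (hφzero 0 u (by rw [abs_of_pos (by linarith [not_le.1 hlt])]; linarith [not_le.1 hlt]))
      exact div_le_div_of_nonneg_left (φ 0).nonneg hu0 hle
  have hn1 : n 1 ≤ m 1 / (c 1 - r) := by
    rw [hm, hn]; dsimp only
    rw [← integral_div]
    refine setIntegral_mono_on (hφint' 1).integrableOn ((hφint 1).div_const _).integrableOn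
      measurableSet_Ioi fun u hu ↦ ?_
    have hu0 : (0 : ℝ) < u := hu
    by_cases hφu : φ 1 u = 0
    · simp [hφu]
    · have hle : c 1 - r ≤ u := by
        by_contra hlt
        exact hφu (hφzero 1 u (by rw [abs_sub_comm, abs_of_pos (by linarith [not_le.1 hlt])]; linarith [not_le.1 hlt]))
      exact div_le_div_of_nonneg_left (φ 1).nonneg hc1r hle
  -- the coefficients: cross product of `m` and `n`
  set l : Fin 3 → ℝ := ![m 1 * n 2 - m 2 * n 1, m 2 * n 0 - m 0 * n 2, m 0 * n 1 - m 1 * n 0]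
    with hl
  have hl0 : l 0 = m 1 * n 2 - m 2 * n 1 := rfl
  have hl1 : l 1 = m 2 * n 0 - m 0 * n 2 := rfl
  have hl2 : l 2 = m 0 * n 1 - m 1 * n 0 := rfl
  have hsum_m : l 0 * m 0 + l 1 * m 1 + l 2 * m 2 = 0 := by rw [hl0, hl1, hl2]; ring
  have hsum_n : l 0 * n 0 + l 1 * n 1 + l 2 * n 2 = 0 := by rw [hl0, hl1, hl2]; ring
  have hl2_neg : l 2 < 0 := by
    rw [hl2, sub_neg]
    have hsep : c 0 + r < c 1 - r := by rw [hc0, hc1, hr]; linarith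
    calc m 0 * n 1 ≤ m 0 * (m 1 / (c 1 - r)) := by gcongr; exact (hm_pos 0).le
      _ = m 0 * m 1 / (c 1 - r) := by ring
      _ < m 0 * m 1 / (c 0 + r) := by
          apply div_lt_div_of_pos_left (mul_pos (hm_pos 0) (hm_pos 1)) hc0r hsep
      _ = m 1 * (m 0 / (c 0 + r)) := by ring
      _ ≤ m 1 * n 0 := by gcongr; exact (hm_pos 1).le
  -- the function
  set α₀ : ℝ → ℝ := fun u ↦ l 0 * φ 0 u + l 1 * φ 1 u + l 2 * φ 2 u with hα₀
  have hα₀_smooth : ContDiff ℝ ((⊤ : ℕ∞) : WithTop ℕ∞) α₀ :=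
    ((contDiff_const.mul (φ 0).contDiff).add (contDiff_const.mul (φ 1).contDiff)).add
      (contDiff_const.mul (φ 2).contDiff)
  have hα₀_small : ∀ u, u ≤ a → α₀ u = 0 := by
    intro u hu; simp [hα₀, hφzero_small _ u hu]
  have hα₀_large : ∀ u, b ≤ u → α₀ u = 0 := by
    intro u hu; simp [hα₀, hφzero_large _ u hu]
  set α : ℝ → ℂ := fun y ↦ ((α₀ y + α₀ (-y) : ℝ) : ℂ) with hα
  have hα_pos : ∀ u, 0 < u → α u = (α₀ u : ℂ) := by
    intro u hu
    rw [hα]; dsimp only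
    rw [hα₀_small (-u) (by linarith), add_zero]
  have hz : ∀ y, |y| < a → α y = 0 := by
    intro y hy
    rw [abs_lt] at hy
    rw [hα]; dsimp only
    rw [hα₀_small y hy.2.le, hα₀_small (-y) (by linarith), add_zero, Complex.ofReal_zero]
  have hz' : ∀ y, b < |y| → α y = 0 := by
    intro y hy
    rw [hα]; dsimp only
    rcases lt_abs.1 hy with h | h
    · rw [hα₀_large y h.le, hα₀_small (-y) (by linarith), add_zero, Complex.ofReal_zero]
    · rw [hα₀_small y (by linarith), hα₀_large (-y) h.le, add_zero, Complex.ofReal_zero]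
  refine ⟨α, ⟨?_, ?_, ?_, ?_⟩, hz, hz', ?_, ?_, ⟨c 2, (by have := (hcin 2).1; linarith),
    (by have := (hcin 2).2; linarith), ?_⟩⟩
  · -- smooth
    exact Complex.ofRealCLM.contDiff.comp (hα₀_smooth.add (hα₀_smooth.comp contDiff_neg))
  · -- even
    intro y; rw [hα]; dsimp only; rw [neg_neg, add_comm]
  · -- compact support
    refine HasCompactSupport.of_support_subset_isCompact (isCompact_Icc (a := -b) (b := b)) ?_
    intro y hy
    by_contra hyI
    apply hy
    apply hz'
    rw [mem_Icc, not_and_or, not_le, not_le] at hyI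
    rcases hyI with h | h
    · rw [abs_of_neg (by linarith)]; linarith
    · rw [abs_of_pos (by linarith)]; exact h
  · -- away from the origin
    intro hmem
    have : α =ᶠ[𝓝 (0 : ℝ)] 0 := by
      filter_upwards [Metric.ball_mem_nhds (0 : ℝ) ha] with y hy
      exact hz y (by simpa using hy)
    exact (notMem_tsupport_iff_eventuallyEq.2 this) hmem
  · -- `∫₀^∞ α = 0`
    have e : ∫ u in Ioi (0 : ℝ), α u = ∫ u in Ioi (0 : ℝ), ((α₀ u : ℝ) : ℂ) :=
      setIntegral_congr_fun measurableSet_Ioi fun u hu ↦ hα_pos u hu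
    rw [e, integral_complex_ofReal]
    have : ∫ u in Ioi (0 : ℝ), α₀ u = l 0 * m 0 + l 1 * m 1 + l 2 * m 2 := by
      rw [hα₀]; dsimp only
      rw [integral_add, integral_add, integral_const_mul, integral_const_mul, integral_const_mul]
      · exact ((hφint 0).const_mul _).integrableOn
      · exact ((hφint 1).const_mul _).integrableOn
      · exact (((hφint 0).const_mul _).add ((hφint 1).const_mul _)).integrableOn
      · exact ((hφint 2).const_mul _).integrableOn
    rw [this, hsum_m, Complex.ofReal_zero]
  · -- `∫₀^∞ α(u)du/u = 0`
    have e : ∫ u in Ioi (0 : ℝ), α u / (u : ℂ) = ∫ u in Ioi (0 : ℝ), ((α₀ u / u : ℝ) : ℂ) :=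
      setIntegral_congr_fun measurableSet_Ioi fun u hu ↦ by
        rw [hα_pos u hu]; push_cast; rfl
    rw [e, integral_complex_ofReal]
    have : ∫ u in Ioi (0 : ℝ), α₀ u / u = l 0 * n 0 + l 1 * n 1 + l 2 * n 2 := by
      have e2 : (fun u : ℝ ↦ α₀ u / u) =
          fun u ↦ l 0 * (φ 0 u / u) + l 1 * (φ 1 u / u) + l 2 * (φ 2 u / u) := by
        funext u; rw [hα₀]; dsimp only; ring
      rw [e2, integral_add, integral_add, integral_const_mul, integral_const_mul, integral_const_mul]
      · exact ((hφint' 0).const_mul _).integrableOn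
      · exact ((hφint' 1).const_mul _).integrableOn
      · exact (((hφint' 0).const_mul _).add ((hφint' 1).const_mul _)).integrableOn
      · exact ((hφint' 2).const_mul _).integrableOn
    rw [this, hsum_n, Complex.ofReal_zero]
  · -- `α(c 2) = l 2 ≠ 0`
    have hc2pos : 0 < c 2 := by have := (hcin 2).1; linarith
    rw [hα_pos _ hc2pos, Complex.ofReal_ne_zero, hα₀]
    dsimp only
    have h0 : φ 0 (c 2) = 0 := hφzero 0 _ (by rw [hc0, hc2, hr, abs_of_pos (by linarith)]; linarith)
    have h1 : φ 1 (c 2) = 0 := hφzero 1 _ (by rw [hc1, hc2, hr, abs_of_pos (by linarith)]; linarith)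
    have h2 : φ 2 (c 2) = 1 :=
      (φ 2).one_of_mem_closedBall (by rw [Metric.mem_closedBall, dist_self, hφrIn]; positivity)
    rw [h0, h1, h2]
    linarith

/-- **The Sonine spaces `K_λ`, `0 < λ < 1`, are non-trivial, by Burnol's co-Poisson construction**
(§6 opening, TeX l.2190–2203: with `α` as above "a non zero function `f(t)` may be obtained this way
only for `0 < λ < 1`"): an explicit `α` with support in `[λ, min(2λ, 1/λ)]` and two vanishing moments
gives `P'(α) ∈ K_λ` with `P'(α) = α ≠ 0` on `(λ, 2λ)`. (For `λ ≥ 1` non-triviality is de Branges'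
theorem, Thm. 6.3, not proved here.) [cite: Burnol2004, §6 (TeX l.2190–2203)] -/
theorem exists_ne_zero_mem_sonineK_of_lt_one {a : ℝ} (ha : 0 < a) (ha1 : a < 1) :
    ∃ f ∈ sonineK a, f ≠ 0 := by
  set b : ℝ := min (2 * a) a⁻¹ with hb
  have hab : a < b := by
    rw [hb, lt_min_iff]; constructor
    · linarith
    · exact ha1.trans ((one_lt_inv₀ ha).2 ha1)
  obtain ⟨α, hα, hz, hz', h0, h1, y₀, hy₀a, hy₀b, hy₀⟩ := exists_testAway_moments ha hab
  have hzb : ∀ y, a⁻¹ < |y| → α y = 0 := fun y hy ↦ hz' y (lt_of_le_of_lt (min_le_right _ _) hy)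
  refine ⟨hα.memLp_two_coSum.toLp (coSum α), hα.toLp_coSum_mem_sonineK ha hz hzb h0 h1,
    hα.toLp_coSum_ne_zero (y₀ := y₀) ?_⟩
  have hy2 : |y₀| < 2 * a := by
    rw [abs_of_pos (ha.trans hy₀a)]
    exact hy₀b.trans_le (min_le_left _ _)
  rw [coSum_eq_sub_of_abs_lt hz hy2, h1, sub_zero]
  exact hy₀

end CoPoissonExamples

/-! ## Prop. 6.7 modulo the Mellin functional equation on `K_λ` -/

section Prop67Reduction

/-- **Prop. 6.7 follows from the functional equation of the entire completed Mellin transform.**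
If for every `λ > 0` and `f ∈ K_λ` the entire completed Mellin transform satisfies
`𝒢_{𝓕₊f}(s) = 𝒢_f(1−s)` (de Branges' theory, [Burnol2004b, Thm. 2.1] — the tree's facts
`Burnol2004b_thm2_1` / `Burnol2004b_prop2_2` (iii) with the uniqueness `HasCompletedMellinEntire.eq`),
then `Burnol2004_prop_6_7` holds: this is Burnol's printed proof "`[𝓕₊(Z^λ_{w,k}), f] =
[Z^λ_{w,k}, 𝓕₊(f)] = M(𝓕₊(f))^{(k)}(w) = (−1)^k M(f)^{(k)}(1−w)`" (TeX l.2376–2379), carried out in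
`BurnolSonineFourier.isSonineZ_fourier_of_functionalEquation`.
[cite: Burnol2004, Proposition 6.7 and its proof (TeX l.2372–2380)] -/
theorem Burnol2004_prop_6_7_of_functionalEquation
    (hFE : ∀ lam : ℝ, 0 < lam → ∀ f ∈ sonineK lam,
      completedMellinEntire (((𝓕 f : Lp ℂ 2 (volume : Measure ℝ)) : Lp ℂ 2 (volume : Measure ℝ)) :
          ℝ → ℂ) =
        fun s ↦ completedMellinEntire (f : ℝ → ℂ) (1 - s)) :
    Burnol2004_prop_6_7 :=
  fun lam hlam _w _k _Z hZ ↦ isSonineZ_fourier_of_functionalEquation (hFE lam hlam) hZ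

end Prop67Reduction

end Literature.NumberTheory.LFunctions
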